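import Summits.MatrixMultiplication.OmegaCensus.STPPKernelListerScanSound

/-!
# ω-census (abelian STPP census): kernel lister — soundness of the search, variant with pruning only after the first block (kernel)

HONEST FRAMING (pub-omega census; verbatim): lottery ticket; floor = certified bounds/negative ranges.
Census STRUCTURE (seat pub-omega-stpp-2 gen 29, 2026-08-29), family (b2).  Pure logic about a finite program; nothing here is progress on `ω`.

`SearchHypH` = `SearchHypU` (`STPPKernelListerScanSound.lean`) with the pruning fact assumed only at states with `st.has0 = true` and `add` recording that
adding a block sets `has0`.  Reason: in `St.budgets` the `qa/qb/qc` budgets at the ROOT state are `n`, which no pattern law backs (`Σ qa ≤ 2n` is the law);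
the root computation `scanFirstC` never consults the bound at the root (the first block is added by `addOne` before any `scanS` prune), so the concrete
instance only has to justify pruning after the first block — where N16 at that block backs the budgets.  Theorems `addOne_soundH` … `scanFirstC_soundH`
(same statements as the `U` forms with `KSpecH`).
-/

namespace Summit.MatrixMultiplication.OmegaCensus.KLister

variable {n : ℕ} {dead : List (List Shape)} {Bad : List Shape → Prop} {Inv : St → List Shape → Prop} {Cov : List ℕ → List Shape → Prop}
variable {U : List Shape}

/-- `SearchHypU` with the pruning fact assumed only at states AFTER the first block (`st.has0 = true`): in `scanFirstC` the volume bound is never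
consulted at the root state, and at the root the `qa/qb/qc` budgets `n` of `St.budgets` are not law-backed (only `2n` is). [folklore] -/
structure SearchHypH (n : ℕ) (dead : List (List Shape)) (U : List Shape) (Bad : List Shape → Prop) (Inv : St → List Shape → Prop)
    (Cov : List ℕ → List Shape → Prop) : Prop where
  /-- a non-beating pattern is not bad -/
  nonbeating : ∀ st P, Inv st P → st.vol ≤ n → ¬ Bad P
  /-- a shape that does not fit a monotone budget kills every extension through it -/
  misfit : ∀ st P s E', s ∈ U → Inv st P → st.fits n s = false → ¬ Bad (P ++ s :: E')
  /-- overshooting the minimality margin kills every extension through it -/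
  overshoot : ∀ st P s E', s ∈ U → Inv st P → n + min st.mm (minprod s) < st.vol + svol s → ¬ Bad (P ++ s :: E')
  /-- an exhausted `Σab` budget kills every proper extension -/
  exhausted : ∀ st P s E', s ∈ U → Inv st P → n ≤ st.sab → ¬ Bad (P ++ s :: E')
  /-- a beating pattern passing `leafOK` is not bad -/
  leaf : ∀ st P, Inv st P → n < st.vol → leafOK n dead st P = true → ¬ Bad P
  /-- a proper extension of a beating pattern is not bad (not minimal) -/
  prefix_beating : ∀ st P E', Inv st P → n < st.vol → E' ≠ [] → ¬ Bad (P ++ E')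
  /-- the pruning bound: rows covering the remaining shapes bound the volume of every extension -/
  prune : ∀ st P rows R E, Inv st P → st.has0 = true → Cov rows R → OrdExt R E → st.vol + bound n st rows ≤ n → ¬ Bad (P ++ E)
  /-- the invariant is preserved by adding a fitting shape of `U`, and `Σab` grows -/
  add : ∀ st P s, s ∈ U → Inv st P → st.fits n s = true → Inv (st.add n s) (P ++ [s]) ∧ st.sab + 1 ≤ (st.add n s).sab ∧ (st.add n s).has0 = true
  /-- coverage is inherited by dropping leading shapes -/
  cov_tail : ∀ rows s R, Cov rows (s :: R) → Cov rows R

/-- `KSpec` restricted to states after the first block. [folklore] -/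
def KSpecH (n : ℕ) (Bad : List Shape → Prop) (Inv : St → List Shape → Prop) (k : St → List Shape → Bool) (R : List Shape) : Prop :=
  ∀ st P, Inv st P → st.vol ≤ n → st.has0 = true → k st P = true → ∀ E, OrdExt R E → ¬ Bad (P ++ E)


/-- **Soundness of `addOne`, relativised.** [folklore] -/
theorem addOne_soundH (H : SearchHypH n dead U Bad Inv Cov) {k : St → List Shape → Bool} {R : List Shape} {s : Shape} (hs : s ∈ U)
    (hk : KSpecH n Bad Inv k R) :
    ∀ (fuel : ℕ) (st : St) (P : List Shape), Inv st P → n ≤ fuel + st.sab → addOne n dead k s fuel st P = true →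
      ∀ E', OrdExt (s :: R) E' → ¬ Bad (P ++ s :: E') := by
  intro fuel
  induction fuel with
  | zero =>
    intro st P hI hf _ E' _
    exact H.exhausted st P s E' hs hI (by simpa using hf)
  | succ fuel ih =>
    intro st P hI hf h E' hE'
    rw [addOne] at h
    cases hfit : st.fits n s with
    | false => exact H.misfit st P s E' hs hI hfit
    | true =>
      rw [hfit] at h
      simp only [Bool.not_true, Bool.false_or, Bool.or_eq_true] at h
      rcases h with h | h
      · exact H.overshoot st P s E' hs hI (by simpa [Nat.blt_eq] using h)
      · obtain ⟨hI', hsab, hh0⟩ := H.add st P s hs hI hfit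
        by_cases hb : n < (st.add n s).vol
        · rw [if_pos hb] at h
          by_cases hE : E' = []
          · subst hE
            exact H.leaf _ _ hI' hb h
          · have := H.prefix_beating _ _ E' hI' hb hE
            simpa [List.append_assoc] using this
        · rw [if_neg hb, Bool.and_eq_true] at h
          obtain ⟨hk0, hrec⟩ := h
          have hvol : (st.add n s).vol ≤ n := Nat.le_of_not_lt hb
          rcases hE'.cons_cases with hR | ⟨E'', rfl, hE''⟩
          · have := hk _ _ hI' hvol hh0 hk0 E' hR
            simpa [List.append_assoc] using this
          · have hf' : n ≤ fuel + (st.add n s).sab := by omega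
            have := ih (st.add n s) (P ++ [s]) hI' hf' hrec E'' hE''
            simpa [List.append_assoc] using this

/-- **Soundness of `scanS`, relativised** (all shapes of the chunk in `U`). [folklore] -/
theorem scanS_soundH (H : SearchHypH n dead U Bad Inv Cov) {rows : List ℕ} {kAfter : St → List Shape → Bool} {Rafter : List Shape}
    (hk : KSpecH n Bad Inv kAfter Rafter) :
    ∀ ss : List Shape, (∀ x ∈ ss, x ∈ U) → Cov rows (ss ++ Rafter) → KSpecH n Bad Inv (scanS n dead rows kAfter ss) (ss ++ Rafter) := by
  intro ss
  induction ss with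
  | nil =>
    intro _ _ st P hI hv hh h E hE
    exact hk st P hI hv hh (by simpa [scanS] using h) E (by simpa using hE)
  | cons s ss ih =>
    intro hU hcov st P hI hv hh h E hE
    rw [scanS, Bool.or_eq_true] at h
    rcases h with hpr | h
    · exact H.prune st P rows (s :: ss ++ Rafter) E hI hh hcov (by simpa using hE) (by simpa [Nat.ble_eq] using hpr)
    · rw [Bool.and_eq_true] at h
      obtain ⟨h0, h1⟩ := h
      have hcov' : Cov rows (ss ++ Rafter) := H.cov_tail rows s _ (by simpa using hcov)
      have hks : KSpecH n Bad Inv (scanS n dead rows kAfter ss) (ss ++ Rafter) := ih (fun x hx => hU x (List.mem_cons_of_mem _ hx)) hcov'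
      have hE' : OrdExt (s :: (ss ++ Rafter)) E := by simpa using hE
      rcases hE'.cons_cases with hR | ⟨E', rfl, hE''⟩
      · exact hks st P hI hv hh h0 E hR
      · exact addOne_soundH H (hU s List.mem_cons_self) hks n st P hI (by omega) h1 E' hE''

/-- **Soundness of `scanC`, relativised** (all shapes of the chunk list in `U`). [folklore] -/
theorem scanC_soundH (H : SearchHypH n dead U Bad Inv Cov) :
    ∀ L : List (List ℕ × List Shape), (∀ x ∈ flat L, x ∈ U) → ChunksCov Cov L → KSpecH n Bad Inv (scanC n dead L) (flat L) := by
  intro L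
  induction L with
  | nil =>
    intro _ _ st P hI hv _ _ E hE
    have hE0 : E = [] := OrdExt.eq_nil (by simpa [flat] using hE)
    subst hE0
    simpa using H.nonbeating st P hI hv
  | cons ch rest ih =>
    obtain ⟨rows, ss⟩ := ch
    intro hU hc st P hI hv hh h E hE
    rw [ChunksCov] at hc
    rw [flat_cons] at hE hU
    exact scanS_soundH H (ih (fun x hx => hU x (List.mem_append_right _ hx)) hc.2) ss
      (fun x hx => hU x (List.mem_append_left _ hx)) hc.1 st P hI hv hh (by simpa [scanC] using h) E hE

/-- **Soundness of `scanFirstS`, relativised.** [folklore] -/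
theorem scanFirstS_soundH (H : SearchHypH n dead U Bad Inv Cov) (hinit : Inv (St.init n) []) {sel : Shape → Bool} {rows : List ℕ}
    {kAfter : St → List Shape → Bool} {Rafter : List Shape} (hk : KSpecH n Bad Inv kAfter Rafter)
    (hlater : ∀ E, OrdExt Rafter E → ∀ s E', E = s :: E' → sel s = true → ¬ Bad E) :
    ∀ ss : List Shape, (∀ x ∈ ss, x ∈ U) → Cov rows (ss ++ Rafter) → scanFirstS n dead sel rows kAfter ss = true →
      ∀ E, OrdExt (ss ++ Rafter) E → ∀ s E', E = s :: E' → sel s = true → ¬ Bad E := by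
  intro ss
  induction ss with
  | nil =>
    intro _ _ _ E hE s E' hEs hsel
    exact hlater E (by simpa using hE) s E' hEs hsel
  | cons t ss ih =>
    intro hU hcov h E hE s E' hEs hsel
    rw [scanFirstS, Bool.and_eq_true] at h
    obtain ⟨h0, h1⟩ := h
    have hcov' : Cov rows (ss ++ Rafter) := H.cov_tail rows t _ (by simpa using hcov)
    have hU' : ∀ x ∈ ss, x ∈ U := fun x hx => hU x (List.mem_cons_of_mem _ hx)
    have hE' : OrdExt (t :: (ss ++ Rafter)) E := by simpa using hE
    rcases hE'.cons_cases with hR | ⟨E'', hEE, hE''⟩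
    · exact ih hU' hcov' h1 E hR s E' hEs hsel
    · subst hEs
      obtain ⟨hst, hEq⟩ := List.cons.inj hEE
      subst hst
      subst hEq
      rw [hsel] at h0
      simp only [Bool.not_true, Bool.false_or] at h0
      have hks : KSpecH n Bad Inv (scanS n dead rows kAfter ss) (ss ++ Rafter) := scanS_soundH H hk ss hU' hcov'
      have hsab : (St.init n).sab = 0 := rfl
      have := addOne_soundH H (hU s List.mem_cons_self) hks n (St.init n) [] hinit (by rw [hsab]; omega) h0 E' hE''
      simpa using this

/-- **Soundness of `scanFirstC`, relativised**: with every shape of `L` in `U`, `scanFirstC n dead sel L = true` excludes every bad NON-EMPTY pattern in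
list order over the shapes of `L` whose first block satisfies `sel`. [folklore] -/
theorem scanFirstC_soundH (H : SearchHypH n dead U Bad Inv Cov) (hinit : Inv (St.init n) []) {sel : Shape → Bool} :
    ∀ L : List (List ℕ × List Shape), (∀ x ∈ flat L, x ∈ U) → ChunksCov Cov L → scanFirstC n dead sel L = true →
      ∀ E, OrdExt (flat L) E → ∀ s E', E = s :: E' → sel s = true → ¬ Bad E := by
  intro L
  induction L with
  | nil =>
    intro _ _ _ E hE s E' hEs _
    have : E = [] := OrdExt.eq_nil (by simpa [flat] using hE)
    rw [this] at hEs; exact absurd hEs (by simp)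
  | cons ch rest ih =>
    obtain ⟨rows, ss⟩ := ch
    intro hU hc h E hE s E' hEs hsel
    rw [ChunksCov] at hc
    rw [scanFirstC, Bool.and_eq_true] at h
    rw [flat_cons] at hE hU
    have hUr : ∀ x ∈ flat rest, x ∈ U := fun x hx => hU x (List.mem_append_right _ hx)
    exact scanFirstS_soundH H hinit (scanC_soundH H rest hUr hc.2) (ih hUr hc.2 h.2) ss (fun x hx => hU x (List.mem_append_left _ hx))
      hc.1 h.1 E hE s E' hEs hsel

end Summit.MatrixMultiplication.OmegaCensus.KLister
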